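import Mathlib
import Summits.AtomisticToContinuum.Crystallization.Theorems.SquareWellLayerCakeStackingFaultSparsityDefs
import Summits.AtomisticToContinuum.Crystallization.Theorems.SquareWellLayerCakeStackingFaultSparsityChainBlockFlip
import Summits.AtomisticToContinuum.Crystallization.Theses.PoissonBesselStacking
import Literature.MathematicalPhysics.StatisticalMechanics.BarlowStackingEnergy
import Literature.MathematicalPhysics.StatisticalMechanics.LennardJonesClusters

/-!
# SURVEY (not a landing file): sub-lemma map of stub `stub_diluteFaults`
# (crux `StackingFaultSparsity`, stmt-AtomisticToContinuum-14296, line `Sketch`)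

Registered stub: `(four Hägg-chain block-flip facts = stub_chainBlockFlip) → DiluteFaults`, with
`DiluteFaults = ∃ M₀ L₀, ∀ L ≥ L₀, ∃ ε₁ > 0, ∀ N x, IsGroundState lennardJones x → ∀ i a h s k i₀ j₀ A,
InBox a h → IsHaggSeq s → TwoWay (barlowStacking a h s) L ε₁ x i (barlowPos a h s k i₀ j₀) A →
(cubicNear s k ⌊L/(2h)⌋₊).card ≤ M₀`.  Mechanism: idea card `Ideas/shockley-slab-restacking.md`.

This file TYPES the sub-lemmas of the finite-`N` transfer (the physics is NOT attempted; every `sorry`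
below is a typed obligation, sizes in the docstrings):

* (P)  `exists_four_close_cubic` — pigeonhole: `> M₀` cubic letters among `2M+1` layers give four cubic
        layers of span `≤ 6M/(M₀-2)` (S, provable now).
* (W)  `exists_enum_window` — finite enumeration of the stacking points in a ball (S, provable now).
* (M3a) `competitor_injective` — the block-shift competitor is injective (M, geometry, provable now).
* (M3b) `interactionEnergy_add_sub` — energy difference = changed-pair sum (S, PROVED here).
* (G)  `changedPairSum_nonneg_of_isGroundState` — `IsGroundState` + (M3a) ⇒ `0 ≤ Δ(x)` (PROVED here).
* (M3c+e) `exactLattice_ledger` — on the EXACT finite lattice window the changed-pair sum of the disc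
        block flip is `≤ ncol · (range-K chain change) + C_rim ρ (m+2K) + C_T ρ² (m+2K) K⁻³`
        (XL bookkeeping: `tsum_layer_above/below`, `layerInteraction_eq_ite`, `barlowCoupling`,
        zero charge ⇒ layers `≥ q₂` are in-layer translates `barlowPos_eq_of_haggLabel_eq`; rim sums and
        `r⁻⁶` half-space tails; NO certified numerics — crude constants).
* (M3d) `perturbative_transfer` — matched configuration versus its exact lattice shadow:
        `|Δ(x) - Δ(P)| ≤ C_p ε₁ ρ² m + C_T ρ² m K⁻³` (L; Lipschitz `abs_lennardJones_sub_le` + shell sums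
        `sum_inv_pow_six_le` / `stub_farTail`; NO Taylor expansion to second order is needed for the
        qualitative stub — first and second order merge into one Lipschitz bound because `ε₁` is chosen
        after `L`).
* (U)  `uniform_gain` — `LjRegistryDomination` (stmt-3063) + continuity/compactness on the box ⇒
        `2J₂ + 2∑_{k=3}^{K}(k-1)|J_k| ≤ -κ < 0` uniformly (M, provable now GIVEN 3063).
* (M3f) `diluteFaults_of_ledger` — assembly (M, pure real bookkeeping; parameter choice in its docstring;
        left `sorry` in this survey for lack of time, the inequality chain is spelled out).

Finding of the survey: for the REGISTERED (qualitative, `∃ M₀`) stub no new sharp certified constant is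
needed — the seam constant `c_s`, the half-space force flip `Σ|∂_z J_k|` and `Σ|∇²V|` of the card only fix
the VALUE of `M₀`; the single signed input is the gain `κ = inf_B |J₂| > 0`, i.e. stmt-3063.
-/

noncomputable section

open scoped BigOperators Classical
open Literature.MathematicalPhysics.StatisticalMechanics
open Summit.AtomisticToContinuum.Crystallization.Theorems.SquareWellLayerCake.StackingFaultSparsity

namespace Summit.AtomisticToContinuum.Crystallization.Theorems.SquareWellLayerCake.StackingFaultSparsity.DiluteFaultsSurvey

local notation "E3" => EuclideanSpace ℝ (Fin 3)

/-! ## (P) Combinatorial front end -/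

/-- **(P) four close cubic layers** (S, provable now).  If more than `M₀ ≥ 3` cubic letters of `s` lie
among the layers `[k - M, k + M]`, then four of them, written as the layers `q = c + 1` FOLLOWING cubic
letters `c` (so that `s (q t) = s (q t - 1)`, the convention of the chain facts), have span
`q 3 - q 0 ≤ 6M/(M₀ - 2)`: sort the `M₀ + 1` letters, the `⌊M₀/3⌋` consecutive triple-gaps sum to
`≤ 2M`. -/
theorem exists_four_close_cubic (s : ℤ → ℤ) (k : ℤ) (M M₀ : ℕ) (hM₀ : 3 ≤ M₀)
    (hcard : M₀ < (cubicNear s k M).card) :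
    ∃ q : Fin 4 → ℤ, StrictMono q ∧ (∀ t, s (q t) = s (q t - 1)) ∧
      (∀ t, k - M + 1 ≤ q t ∧ q t ≤ k + M + 1) ∧
      ((q 3 : ℝ) - q 0) ≤ 6 * M / ((M₀ : ℝ) - 2) := by
  sorry

/-- **(W) finite enumeration of a window of the stacking** (S, provable now: the stacking is
`min a h`-separated, `le_dist_of_mem_barlowStacking`, so a ball meets it in a finite set). -/
theorem exists_enum_window (a h : ℝ) (s : ℤ → ℤ) (c : E3) (R : ℝ) (ha : 0 < a) (hh : 0 < h) :
    ∃ (N' : ℕ) (P : Fin N' → E3), Function.Injective P ∧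
      Set.range P = {p ∈ barlowStacking a h s | dist p c ≤ R} := by
  sorry

/-! ## The competitor (definitions of the survey; a landing file would print them unfolded or put
them in the `…Defs.lean` vocabulary) -/

/-- Registry sign `σ_n ∈ {-1, 0, 1}` of layer `n` under the flip of the block starting at `q₁`:
`σ_n ≡ haggLabel s n - haggLabel s q₁ (mod 3)` (the flipped word `s'` has
`haggLabel s' n - haggLabel s n = 2 (haggLabel s q₁ - haggLabel s n) ≡ σ_n`, so layer `n` of `s'` is
layer `n` of `s` shifted in-plane by `σ_n • barlowOffset a`, up to an in-layer lattice translation,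
`barlowPos_eq_of_haggLabel_eq`; `σ_{q₁} = 0`, and `σ_n = 0` for `n ≥ q₂` iff the block has zero
charge). -/
def shiftSign (s : ℤ → ℤ) (q₁ n : ℤ) : ℤ :=
  (haggLabel s n - haggLabel s q₁ + 1) % 3 - 1

/-- Squared LATERAL distance (first two coordinates) — the moved region is a vertical cylinder, not
a ball (the sheared `barlowPos` indexing drifts laterally with `haggLabel`, and a ball would make
the per-layer site counts differ by more than `O(ρ)`). -/
def latSq (p c : E3) : ℝ :=
  (p 0 - c 0) ^ 2 + (p 1 - c 1) ^ 2

/-- The moved cylinder: stacking index `(n, i', j')` with `q₁ < n < q₂` and lateral distance `≤ ρ`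
from the block base point `barlowPos a h s q₁ i₀ j₀`. -/
def InCyl (a h : ℝ) (s : ℤ → ℤ) (q₁ q₂ i₀ j₀ : ℤ) (ρ : ℝ) (n i' j' : ℤ) : Prop :=
  q₁ < n ∧ n < q₂ ∧ latSq (barlowPos a h s n i' j') (barlowPos a h s q₁ i₀ j₀) ≤ ρ ^ 2

/-- **The block-shift displacement of particle `j`** of the matched configuration `x` (window of `i`,
based at `z = barlowPos a h s k i₀ j₀`, isometry `A`): if `x j` is within `ε₁` of the image
`x i + A (p - z)` of a cylinder point `p = barlowPos a h s n i' j'`, move it by `A (σ_n • w)`, else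
leave it (for `2ε₁ < min a h` the cylinder point is unique, so `choose` is harmless). -/
def blockShift (a h : ℝ) (s : ℤ → ℤ) (k i₀ j₀ q₁ q₂ : ℤ) (ρ ε₁ : ℝ) {N : ℕ} (x : Fin N → E3)
    (i : Fin N) (A : E3 →ₗᵢ[ℝ] E3) (j : Fin N) : E3 :=
  if hj : ∃ n i' j' : ℤ, InCyl a h s q₁ q₂ i₀ j₀ ρ n i' j' ∧
      dist (x j) (x i + A (barlowPos a h s n i' j' - barlowPos a h s k i₀ j₀)) ≤ ε₁
  then A ((shiftSign s q₁ hj.choose : ℝ) • barlowOffset a) else 0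

/-- The same displacement on an enumerated EXACT lattice window `P` (no isometry, no tolerance). -/
def latticeShift (a h : ℝ) (s : ℤ → ℤ) (q₁ q₂ i₀ j₀ : ℤ) (ρ : ℝ) {N' : ℕ} (P : Fin N' → E3)
    (j : Fin N') : E3 :=
  if hj : ∃ n i' j' : ℤ, InCyl a h s q₁ q₂ i₀ j₀ ρ n i' j' ∧ P j = barlowPos a h s n i' j'
  then (shiftSign s q₁ hj.choose : ℝ) • barlowOffset a else 0

/-- **The changed-pair sum** of a displacement field `d` on a configuration `x`: pairs whose two
endpoints move by different vectors, new minus old pair energy. -/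
def changedPairSum (V : ℝ → ℝ) {N : ℕ} (x d : Fin N → E3) : ℝ :=
  ∑ i, ∑ j ∈ Finset.Ioi i,
    if d i = d j then 0 else (V (dist (x i + d i) (x j + d j)) - V (dist (x i) (x j)))

/-! ## (M3b) energy difference = changed-pair sum (proved) -/

/-- **(M3b)** `E(x + d) - E(x)` is the changed-pair sum: a pair moved rigidly keeps its distance.
[folklore] -/
theorem interactionEnergy_add_sub (V : ℝ → ℝ) {N : ℕ} (x d : Fin N → E3) :
    interactionEnergy V (x + d) - interactionEnergy V x = changedPairSum V x d := by
  unfold interactionEnergy changedPairSum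
  rw [← Finset.sum_sub_distrib]
  refine Finset.sum_congr rfl fun i _ => ?_
  rw [← Finset.sum_sub_distrib]
  refine Finset.sum_congr rfl fun j _ => ?_
  simp only [Pi.add_apply]
  split_ifs with hij
  · rw [hij, dist_add_right, sub_self]
  · rfl

/-- **(G) the ground-state comparison**: if `x` is a Lennard-Jones ground state and the competitor
`x + d` is injective then the changed-pair sum is `≥ 0` (`groundStateEnergy_lennardJones_le`).
[folklore] -/
theorem changedPairSum_nonneg_of_isGroundState {N : ℕ} {x d : Fin N → E3}
    (hx : IsGroundState lennardJones x) (hinj : Function.Injective (x + d)) :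
    0 ≤ changedPairSum lennardJones x d := by
  rw [← interactionEnergy_add_sub]
  have h1 := groundStateEnergy_lennardJones_le (d := 3) hinj
  rw [← hx.2] at h1
  linarith

/-! ## (M3a) injectivity of the competitor -/

/-- **(M3a) the competitor is injective** (M, geometry, provable now).  Box parameters give
`a/√3 ≥ 0.54 > 2ε₁` and `h ≥ 0.73 > 2ε₁` for `ε₁ < 1/8`: a particle is within `ε₁` of at most one
image point; two particles moved by the same vector stay distinct; a moved particle sits within `ε₁`
of the image of a HOLE `p + σ w` (`σ = ±1`) of its layer, at distance `≥ a/√3` from every stacking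
point of that layer and `≥ h` from the other layers, while every particle within `L` of `x i` is
within `ε₁` of the image of a stacking point (second matching clause) and the particles beyond `L`
are out of reach (the geometric hypothesis keeps the cylinder `≥ 2` inside the window). -/
theorem competitor_injective :
    ∀ (a h : ℝ) (s : ℤ → ℤ) (k i₀ j₀ q₁ q₂ : ℤ) (ρ ε₁ L : ℝ) {N : ℕ} (x : Fin N → E3) (i : Fin N)
      (A : E3 →ₗᵢ[ℝ] E3), InBox a h → IsHaggSeq s → 0 < ε₁ → ε₁ < 1 / 8 → 0 ≤ ρ →
      |((q₁ : ℝ) - k) * h| + ((q₂ : ℝ) - q₁) * h + ρ + 2 ≤ L →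
      Function.Injective x →
      TwoWay (barlowStacking a h s) L ε₁ x i (barlowPos a h s k i₀ j₀) A →
      Function.Injective (x + blockShift a h s k i₀ j₀ q₁ q₂ ρ ε₁ x i A) := by
  sorry

/-! ## (M3c + M3e) the exact-lattice ledger of the finite disc block flip -/

/-- **(M3c+e) exact-lattice ledger** (XL bookkeeping, no numerics).  There are `c_col > 0` (columns per
unit disc area, `≈ 2/(√3 a²) · π`, uniform on the box), a rim constant `C_rim` and a tail constant
`C_T` such that for every `K ≥ 2`, every box stacking, every ZERO-CHARGE block `[q₁, q₂)` and every
finite enumeration `P` of the stacking points within `R ≥ ρ + (q₂ - q₁ + K) h + 1` of the block base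
point, the changed-pair sum of the cylinder flip `latticeShift` is at most
`ncol · ∑_{m = q₁-K}^{q₂} (haggLocalEnergyTrunc K J s' m - haggLocalEnergyTrunc K J s m)`
(`J = barlowCoupling lennardJones a h`, `s'` the flipped word, `ncol ≥ c_col ρ²` the number of columns
of the disc) `+ C_rim ρ (q₂ - q₁ + 2K)` (lateral rim: pairs crossing the cylinder wall, `∑ r⁻³` over
the depth `r`, and the `O(ρ)` discrepancy of per-layer disc counts between translates of the
triangular lattice) `+ C_T ρ² (q₂ - q₁ + 2K) K⁻³` (pairs at layer distance `> K`, `r⁻⁶` half-space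
tails beyond `K h`).  Identification of the bulk: for a disc site `p` of layer `m` and `2 ≤ k ≤ K`, the
full layer `m + k` contributes `layerInteraction (L'(m+k) - L'(m)) k - layerInteraction (L(m+k) - L(m)) k
= (1[aligned_{s'}(m,k)] - 1[aligned_s(m,k)]) J_k` (`tsum_layer_above`, `layerInteraction_eq_ite`,
`ite_layerInteraction_eq`), the moved layers of the finite competitor being in-layer translates of the
layers of `barlowStacking a h s'` (`shiftSign`, `barlowPos_eq_of_haggLabel_eq`; zero charge makes the
layers `≥ q₂` fixed); summing over the `n_m = ncol + O(ρ)` disc sites of layer `m` and over `m` gives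
`ncol · ∑_m ΔF_K(m)`, and `ΔF_K(m) = 0` off `[q₁ - K, q₂)` (chain fact (c)). -/
theorem exactLattice_ledger :
    ∃ (c_col C_rim C_T : ℝ), 0 < c_col ∧ 0 ≤ C_rim ∧ 0 ≤ C_T ∧ ∀ K : ℕ, 2 ≤ K →
      ∀ (a h : ℝ) (s : ℤ → ℤ) (q₁ q₂ i₀ j₀ : ℤ) (ρ R : ℝ) {N' : ℕ} (P : Fin N' → E3),
        InBox a h → IsHaggSeq s → q₁ < q₂ → (3 : ℤ) ∣ haggLabel s q₂ - haggLabel s q₁ → 1 ≤ ρ →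
        ρ + ((q₂ : ℝ) - q₁) * h + K * h + 1 ≤ R →
        Function.Injective P →
        Set.range P = {p ∈ barlowStacking a h s | dist p (barlowPos a h s q₁ i₀ j₀) ≤ R} →
        ∃ ncol : ℕ, c_col * ρ ^ 2 ≤ ncol ∧
          changedPairSum lennardJones P (latticeShift a h s q₁ q₂ i₀ j₀ ρ P) ≤
            ncol * ∑ m ∈ Finset.Icc (q₁ - K) q₂,
                (haggLocalEnergyTrunc K (barlowCoupling lennardJones a h)
                    (fun n : ℤ => if q₁ ≤ n ∧ n < q₂ then -s n else s n) m -
                  haggLocalEnergyTrunc K (barlowCoupling lennardJones a h) s m) +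
              C_rim * ρ * ((q₂ : ℝ) - q₁ + 2 * K) +
              C_T * ρ ^ 2 * ((q₂ : ℝ) - q₁ + 2 * K) * (K : ℝ)⁻¹ ^ 3 := by
  sorry

/-! ## (M3d) perturbative transfer: matched window versus its exact lattice shadow -/

/-- **(M3d) perturbative transfer** (L, provable now in principle; crude constants).  For a
`d₀`-separated configuration `x` whose window is two-way `(L, ε₁)`-matched (`ε₁ ≤ d₀/4`, so the
matching particle ↔ stacking point is a bijection near the cylinder) and the enumeration `P` of the
stacking points within `R` of the block base point (`R ≥ ρ + (q₂ - q₁ + K) h + 1`, the ball `R + 1`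
around the base inside the `L`-window), the changed-pair sums of `blockShift` on `x` and of
`latticeShift` on `P` differ by at most `C_p ε₁ ρ² (q₂ - q₁)` (pairs with both endpoints shadowed in
`P`: `|V(r) - V(r')| ≤ C (r⁻⁶ + r'⁻⁶)|r - r'|`, `abs_lennardJones_sub_le`, `|r - r'| ≤ 2ε₁`, shell sums
`sum_inv_pow_six_le` over the `≤ C ρ² (q₂ - q₁)` moved particles) `+ C_T ρ² (q₂ - q₁) K⁻³` (pairs
between a moved particle and a particle not shadowed in `P`: at distance `≥ K h`, far tails
`stub_farTail`).  First and second order in `δ = x - X` are NOT separated: for the qualitative stub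
(`∃ ε₁` after `∀ L`) one Lipschitz bound suffices; the card's force-balance / half-space-force-flip /
`600 ε₁²` analysis only sharpens `C_p`. -/
theorem perturbative_transfer :
    ∀ d₀ : ℝ, 0 < d₀ → ∃ (C_p C_T : ℝ), 0 ≤ C_p ∧ 0 ≤ C_T ∧ ∀ K : ℕ, 2 ≤ K →
      ∀ (a h : ℝ) (s : ℤ → ℤ) (k i₀ j₀ q₁ q₂ : ℤ) (ρ ε₁ L R : ℝ) {N : ℕ} (x : Fin N → E3)
        (i : Fin N) (A : E3 →ₗᵢ[ℝ] E3) {N' : ℕ} (P : Fin N' → E3),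
        InBox a h → IsHaggSeq s → q₁ < q₂ → 0 < ε₁ → ε₁ ≤ d₀ / 4 → ε₁ < 1 / 8 → 1 ≤ ρ →
        ρ + ((q₂ : ℝ) - q₁) * h + K * h + 1 ≤ R →
        |((q₁ : ℝ) - k) * h| + R + 1 ≤ L →
        (∀ j j' : Fin N, j ≠ j' → d₀ ≤ dist (x j) (x j')) →
        TwoWay (barlowStacking a h s) L ε₁ x i (barlowPos a h s k i₀ j₀) A →
        Function.Injective P →
        Set.range P = {p ∈ barlowStacking a h s | dist p (barlowPos a h s q₁ i₀ j₀) ≤ R} →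
        |changedPairSum lennardJones x (blockShift a h s k i₀ j₀ q₁ q₂ ρ ε₁ x i A) -
            changedPairSum lennardJones P (latticeShift a h s q₁ q₂ i₀ j₀ ρ P)| ≤
          C_p * ε₁ * ρ ^ 2 * ((q₂ : ℝ) - q₁) + C_T * ρ ^ 2 * ((q₂ : ℝ) - q₁) * (K : ℝ)⁻¹ ^ 3 := by
  sorry

/-! ## (U) the uniform gain on the box (needs stmt-3063) -/

/-- **(U) uniform gain** (M, provable now GIVEN `LjRegistryDomination` = stmt-AtomisticToContinuum-3063):
on the box `J₂ < 0` and `∑_{k ≥ 3} (k-1)|J_k| ≤ |J₂|/2`, so `2J₂ + 2∑_{k=3}^{K} (k-1)|J_k| ≤ J₂ = -|J₂|`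
for every `K`; `(a, h) ↦ J₂(a, h)` is continuous on the compact box
(`MinMeanCycleStackingLockLockedBoxMinimiserLayerSums.continuousOn_barlowCoupling`), hence bounded away
from `0`: `κ = inf_B |J₂| > 0` (numerically `3.68e-5`). -/
theorem uniform_gain
    (hD : Summit.AtomisticToContinuum.Crystallization.Theses.PoissonBesselStacking.LjRegistryDomination) :
    ∃ κ : ℝ, 0 < κ ∧ ∀ a h : ℝ, InBox a h → ∀ K : ℕ, 2 ≤ K →
      2 * barlowCoupling lennardJones a h 2 +
          2 * ∑ k ∈ Finset.Icc 3 K, ((k : ℝ) - 1) * |barlowCoupling lennardJones a h k| ≤ -κ := by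
  sorry

/-! ## (M3f) assembly -/

/-- **(M3f) assembly** (M, pure real bookkeeping over (P), (W), (M3a)–(M3e), (G), (U), the chain facts
and `LennardJonesMinimalDistance_holds`; `sorry` in this survey).  Parameter choice: `d₀` from the
minimal distance; `κ` from (U); `c_col, C_rim, C_T` from (M3c+e); `C_p, C_T'` from (M3d) at `d₀`.
`M₀ := ⌈2 + 200 C_rim / (κ c_col h_min)⌉₊ ⊔ 3` (`h_min = 39/50 · 47/50`), so that the rim term
`C_rim (L/4) · 6M/(M₀-2)`, `M = ⌊L/(2h)⌋₊ ≤ L/(2h)`, is `≤ κ c_col (L/4)²/8`.  Given `L ≥ L₀` put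
`ρ := L/4`, `K := ⌈√L⌉₊`, `R := ρ + (6M/(M₀-2) + K) h + 1` (`≤ 3L/4 - L/ (2) …` fits in the window for
`L ≥ L₀(M₀)`), and `ε₁ := min (d₀/4) (min (1/16) (κ c_col h_min (M₀ - 2) / (100 (C_p + 1) L)))`.
If a window carried `> M₀` cubic letters: (P) gives four cubic layers of span `m ≤ 6M/(M₀-2)`, chain
fact (a) a zero-charge sub-block `[q₁, q₂)` with cubic ends and `q₂ - q₁ ≤ m`; (W) enumerates `P`;
(M3c+e) and chain fact (d) with (U) give `Δ(P) ≤ -κ c_col ρ² + C_rim ρ (m + 2K) + C_T ρ² (m+2K) K⁻³`;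
(M3d) gives `Δ(x) ≤ Δ(P) + C_p ε₁ ρ² m + C_T' ρ² m K⁻³`; (M3a) and (G) give `0 ≤ Δ(x)`.  With the
choices above every positive term is `≤ κ c_col ρ²/8` for `L ≥ L₀` (the `K`-terms because
`(m + 2K) K⁻³ ≤ (L + 2√L) L^{-3/2} → 0`, the `ε₁`-term because `ε₁ m ≤ κ c_col/(8 C_p)`), a
contradiction. -/
theorem diluteFaults_of_ledger
    (hD : Summit.AtomisticToContinuum.Crystallization.Theses.PoissonBesselStacking.LjRegistryDomination) :
    (∀ (s : ℤ → ℤ) (q : Fin 4 → ℤ), StrictMono q →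
      ∃ i j : Fin 4, q i < q j ∧ (3 : ℤ) ∣ haggLabel s (q j) - haggLabel s (q i)) ∧
    (∀ (s : ℤ → ℤ) (q₁ q₂ : ℤ), IsHaggSeq s → q₁ < q₂ → s q₁ = s (q₁ - 1) → s q₂ = s (q₂ - 1) →
      ∀ m : ℤ,
        ((fun n : ℤ => if q₁ ≤ n ∧ n < q₂ then -s n else s n) (m + 1) =
            (fun n : ℤ => if q₁ ≤ n ∧ n < q₂ then -s n else s n) m) ↔
          (s (m + 1) = s m ∧ m ≠ q₁ - 1 ∧ m ≠ q₂ - 1)) ∧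
    (∀ (K : ℕ) (J : ℕ → ℝ) (s : ℤ → ℤ) (q₁ q₂ m : ℤ), (m + K < q₁ ∨ q₂ ≤ m) →
      haggLocalEnergyTrunc K J (fun n : ℤ => if q₁ ≤ n ∧ n < q₂ then -s n else s n) m =
        haggLocalEnergyTrunc K J s m) ∧
    (∀ (K : ℕ) (J : ℕ → ℝ) (s : ℤ → ℤ) (q₁ q₂ : ℤ), IsHaggSeq s → q₁ < q₂ →
      (3 : ℤ) ∣ haggLabel s q₂ - haggLabel s q₁ → s q₁ = s (q₁ - 1) → s q₂ = s (q₂ - 1) → 2 ≤ K →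
      ∑ m ∈ Finset.Icc (q₁ - K) q₂,
          (haggLocalEnergyTrunc K J (fun n : ℤ => if q₁ ≤ n ∧ n < q₂ then -s n else s n) m -
            haggLocalEnergyTrunc K J s m) ≤
        2 * J 2 + 2 * ∑ k ∈ Finset.Icc 3 K, ((k : ℝ) - 1) * |J k|) →
    ∃ (M₀ : ℕ) (L₀ : ℝ), ∀ L : ℝ, L₀ ≤ L → ∃ ε₁ : ℝ, 0 < ε₁ ∧
      ∀ (N : ℕ) (x : Fin N → E3), IsGroundState lennardJones x →
        ∀ (i : Fin N) (a h : ℝ) (s : ℤ → ℤ) (k i₀ j₀ : ℤ) (A : E3 →ₗᵢ[ℝ] E3), InBox a h →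
          IsHaggSeq s → TwoWay (barlowStacking a h s) L ε₁ x i (barlowPos a h s k i₀ j₀) A →
          (cubicNear s k ⌊L / (2 * h)⌋₊).card ≤ M₀ := by
  sorry

/-- The registered stub with stmt-3063 made explicit (what `stub_diluteFaults` would be fed in
`selection_count` once 3063 is certified): chain facts ∧ `LjRegistryDomination` ⇒ `DiluteFaults`. -/
theorem stub_diluteFaults_of_domination
    (hD : Summit.AtomisticToContinuum.Crystallization.Theses.PoissonBesselStacking.LjRegistryDomination) :
    ∃ (M₀ : ℕ) (L₀ : ℝ), ∀ L : ℝ, L₀ ≤ L → ∃ ε₁ : ℝ, 0 < ε₁ ∧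
      ∀ (N : ℕ) (x : Fin N → E3), IsGroundState lennardJones x →
        ∀ (i : Fin N) (a h : ℝ) (s : ℤ → ℤ) (k i₀ j₀ : ℤ) (A : E3 →ₗᵢ[ℝ] E3), InBox a h →
          IsHaggSeq s → TwoWay (barlowStacking a h s) L ε₁ x i (barlowPos a h s k i₀ j₀) A →
          (cubicNear s k ⌊L / (2 * h)⌋₊).card ≤ M₀ :=
  diluteFaults_of_ledger hD stub_chainBlockFlip

end Summit.AtomisticToContinuum.Crystallization.Theorems.SquareWellLayerCake.StackingFaultSparsity.DiluteFaultsSurvey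

end
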